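import Mathlib
import Literature.Geometry.Lorentzian.Basic
import Literature.Geometry.Lorentzian.KerrEnergyIdentity
import Literature.Analysis.FunctionSpaces.ParametricIntegralSmooth
import Summits.FinalStateConjecture.FinalStateConjecture.Theorems.StarvedNecksNecksCertifyStubSphereMeanDarbouxHelpers
import Summits.FinalStateConjecture.FinalStateConjecture.Theorems.StarvedNecksNecksCertifyStubSphereMeanDarboux
import Summits.FinalStateConjecture.FinalStateConjecture.Theorems.StarvedNecksNecksCertifyStubSphericalMeansCalculus

/-!
# Thesis `EIHFluxBalance`, crux `ModulatedKerrHandoff`, line `cone-rates-are-iled`: stub S2a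

Stub `stub_sphericalMeansCalculusC2`: the calculus of the time-dependent spherical means
`A(s, r) = ∫_{S²} ψ(s, x + r w) dσ(w)` (`σ = volume.toSphere`, the finite surface measure on the
unit sphere of `E3`) of a `C²` function `ψ : E4 → ℝ` about a spatial centre `x : E3` — the
statement of the tree's `stub_sphericalMeansCalculus` (smooth `ψ`) with `C^∞` weakened to `C²`:

* `A` is jointly `C²` on `ℝ²` (`contDiff_nat_parametric_integral_of_contDiff`: a parametric
  integral of a `Cⁿ` family over a compact set is `Cⁿ` — the `Cⁿ` analogue of the tree's
  `Literature.Analysis.FunctionSpaces.contDiff_nat_parametric_integral`, same induction);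
* `∂ᵣA = ∫ Dψ(s, x + rw)·(0, w)`, `∂ₛA = ∫ ∂₀ψ(s, x + rw)`, `∂ₛ²A = ∫ ∂₀∂₀ψ(s, x + rw)` — one
  derivative under the integral sign for `C¹` integrands over the compact sphere
  (`hasDerivAt_integral_toSphere_of_contDiff`) plus the chain rule through the affine slice maps;
* DARBOUX in the radius, `∂ᵣ²(r A(s, r)) = r ∫ (Δₓψ)(s, x + rw) dσ`, for the `C²` slice
  `f = ψ(s, ·)` (`sphereMean_darboux_C2`, from the tree's `integral_laplacian_toSphere`, which is
  stated for `C²` functions, exactly as in the tree's `stub_sphereMeanDarboux`).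

The proofs are those of the tree files `…Theorems.StarvedNecksNecksCertifyStubSphericalMeansCalculus`
and `…StubSphereMeanDarboux` and of `Literature.Analysis.FunctionSpaces.ParametricIntegralSmooth`
with the regularity bookkeeping weakened from `C^∞` to `C¹`/`C²`; Mathlib + those tree files; no
definitions, no named facts.
-/

noncomputable section

open scoped Manifold ContDiff Topology ENNReal BigOperators
open Filter Set MeasureTheory Metric Function Literature.Geometry.Lorentzian

-- the doubled `FinalStateConjecture.FinalStateConjecture` path component trips dupNamespace
set_option linter.dupNamespace false
set_option linter.style.longLine false

namespace Summit.FinalStateConjecture.FinalStateConjecture.Theorems.EIHFluxBalance.ConeRatesAreILED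

open Literature.Analysis.FunctionSpaces
open Summit.FinalStateConjecture.FinalStateConjecture.Theorems.NecksCertifyTwoCap.SphericalMeans
open Summit.FinalStateConjecture.FinalStateConjecture.Theorems.NecksCertifyTwoCap.Darboux

/-! ### `Cⁿ` parametric integrals against a finite measure concentrated on a compact set -/

section Parametric

variable {W : Type*} [MeasurableSpace W] {μ : Measure W} [IsFiniteMeasure μ]
variable {V : Type*} [NormedAddCommGroup V] [NormedSpace ℝ V] [SecondCountableTopology V]
  [MeasurableSpace V] [BorelSpace V]
variable {P : Type*} [NormedAddCommGroup P] [NormedSpace ℝ P] [FiniteDimensional ℝ P]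
variable {F : Type*} [NormedAddCommGroup F] [NormedSpace ℝ F]

/-- **`Cⁿ` dependence on parameters** of integrals against a finite measure concentrated on a
compact set: if `G : V × P → F` is `Cⁿ` (`P` finite dimensional), `ι : W → V` is measurable with
values a.e. in a compact `K ⊆ V` and `μ` is a finite measure on `W`, then `p ↦ ∫ G (ι w, p) dμ(w)`
is `Cⁿ` (induction on `n`: the directional derivatives are the parametric integrals of the `Cⁿ⁻¹`
functions `(y, p) ↦ D G (y, p) (0, v)`; Hörmander I, Thm. 1.1.9). [folklore] -/
theorem contDiff_nat_parametric_integral_of_contDiff {ι : W → V} (hι : Measurable ι)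
    {K : Set V} (hK : IsCompact K) (hιK : ∀ᵐ w ∂μ, ι w ∈ K) :
    ∀ (n : ℕ) {G : V × P → F}, ContDiff ℝ n G → ContDiff ℝ n fun p : P ↦ ∫ w, G (ι w, p) ∂μ
  -- adapted from Literature/Analysis/FunctionSpaces/ParametricIntegralSmooth.lean
  | 0, G, hG => by
    rw [Nat.cast_zero, contDiff_zero]
    exact continuous_parametric_integral hι hK hιK hG.continuous
  | n + 1, G, hG => by
    have h1 : ((n + 1 : ℕ) : WithTop ℕ∞) ≠ 0 := by exact_mod_cast Nat.succ_ne_zero n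
    have hd := differentiable_parametric_integral hι hK hιK hG h1
    have hv : ∀ v : P, (fun p : P ↦ fderiv ℝ (fun p : P ↦ ∫ w, G (ι w, p) ∂μ) p v) =
        fun p : P ↦ ∫ w, fderiv ℝ G (ι w, p) ((0 : V), v) ∂μ :=
      fun v ↦ funext fun p ↦ fderiv_parametric_integral_apply hι hK hιK hG h1 p v
    rw [Nat.cast_succ] at hG ⊢
    rw [contDiff_succ_iff_fderiv_apply]
    refine ⟨hd, fun h ↦ absurd h (WithTop.natCast_ne_top n), fun v ↦ ?_⟩
    rw [hv v]
    exact contDiff_nat_parametric_integral_of_contDiff hι hK hιK n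
      (G := fun q ↦ fderiv ℝ G q ((0 : V), v))
      ((hG.fderiv_right (m := n) le_rfl).clm_apply contDiff_const)

end Parametric

/-! ### One derivative under the integral sign over the unit sphere -/

/-- **One derivative under the integral sign over the unit sphere.** If `G : E3 × ℝ → ℝ` is `C¹`
and `s ↦ G (y, s)` has derivative `G' y` at `t` for every `y`, then `s ↦ ∫_{S²} G (w, s) dσ(w)`
has derivative `∫_{S²} G' w dσ(w)` at `t` (the tree's `differentiable_parametric_integral` and
`fderiv_parametric_integral_apply` over the compact sphere, plus uniqueness of the derivative of
`s ↦ G (y, s)`). [folklore] -/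
theorem hasDerivAt_integral_toSphere_of_contDiff {G : E3 × ℝ → ℝ} (hG : ContDiff ℝ 1 G)
    {G' : E3 → ℝ} {t : ℝ} (hG' : ∀ y : E3, HasDerivAt (fun s : ℝ ↦ G (y, s)) (G' y) t) :
    HasDerivAt (fun s : ℝ ↦ ∫ w : Metric.sphere (0 : E3) 1, G ((w : E3), s)
        ∂((volume : Measure E3).toSphere))
      (∫ w : Metric.sphere (0 : E3) 1, G' (w : E3) ∂((volume : Measure E3).toSphere)) t := by
  -- adapted from …Theorems/StarvedNecksNecksCertifyStubSphereMeanDarboux.lean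
  have h1 : (1 : WithTop ℕ∞) ≠ 0 := one_ne_zero
  have hK := isCompact_sphere (0 : E3) (1 : ℝ)
  have hmem : ∀ᵐ w ∂((volume : Measure E3).toSphere),
      ((w : Metric.sphere (0 : E3) 1) : E3) ∈ Metric.sphere (0 : E3) 1 := ae_of_all _ fun w ↦ w.2
  have hdiff := differentiable_parametric_integral (μ := (volume : Measure E3).toSphere)
    measurable_subtype_coe hK hmem hG h1 t
  have happ := fderiv_parametric_integral_apply (μ := (volume : Measure E3).toSphere)
    measurable_subtype_coe hK hmem hG h1 t 1
  have hpt : ∀ y : E3, fderiv ℝ G (y, t) ((0 : E3), (1 : ℝ)) = G' y := fun y ↦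
    (((hG.differentiable h1) (y, t)).hasFDerivAt.comp_hasDerivAt t
      ((hasDerivAt_const t y).prodMk (hasDerivAt_id t))).unique (hG' y)
  refine hdiff.hasDerivAt.congr_deriv ?_
  rw [← fderiv_apply_one_eq_deriv, happ]
  exact integral_congr_ae (ae_of_all _ fun w ↦ hpt w)

/-! ### Darboux's equation for the spherical means of a `C²` function on `E3` -/

/-- **First derivative of the spherical mean of a `C¹` function**: `M(ρ) = ∫ f(x + ρw) dσ` has
`M'(ρ) = ∫ Df(x + ρw)(w) dσ`. [folklore] -/
theorem hasDerivAt_sphereMean_C1 {f : E3 → ℝ} (hf : ContDiff ℝ 1 f) (x : E3) (ρ : ℝ) :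
    HasDerivAt (fun ρ : ℝ ↦ ∫ w : Metric.sphere (0 : E3) 1, f (x + ρ • (w : E3))
        ∂((volume : Measure E3).toSphere))
      (∫ w : Metric.sphere (0 : E3) 1, fderiv ℝ f (x + ρ • (w : E3)) (w : E3)
        ∂((volume : Measure E3).toSphere)) ρ := by
  -- adapted from …Theorems/StarvedNecksNecksCertifyStubSphereMeanDarboux.lean
  have hG : ContDiff ℝ 1 (fun q : E3 × ℝ ↦ f (x + q.2 • q.1)) :=
    hf.comp (contDiff_const.add (contDiff_snd.smul contDiff_fst))
  refine hasDerivAt_integral_toSphere_of_contDiff hG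
    (G' := fun y ↦ fderiv ℝ f (x + ρ • y) y) fun y ↦ ?_
  have haff : HasDerivAt (fun s : ℝ ↦ x + s • y) y ρ := by
    simpa using ((hasDerivAt_id ρ).smul_const y).const_add x
  exact ((hf.differentiable one_ne_zero) (x + ρ • y)).hasFDerivAt.comp_hasDerivAt ρ haff

/-- Second derivatives through the dilation for `f ∈ C²`:
`D²[y ↦ f (x + ρ y)](w)(u)(v) = ρ² D²f(x + ρ w)(u)(v)`. [folklore] -/
theorem fderiv_fderiv_comp_dilation_apply_C2 {f : E3 → ℝ} (hf : ContDiff ℝ 2 f) (x : E3) (ρ : ℝ)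
    (w u v : E3) :
    fderiv ℝ (fderiv ℝ (fun y ↦ f (x + ρ • y))) w u v =
      ρ ^ 2 * fderiv ℝ (fderiv ℝ f) (x + ρ • w) u v := by
  -- adapted from …Theorems/StarvedNecksNecksCertifyStubSphereMeanDarboux.lean
  have h12 : (1 : WithTop ℕ∞) + 1 ≤ 2 := by norm_num
  have hfd : Differentiable ℝ f := hf.differentiable two_ne_zero
  have hDf : Differentiable ℝ (fderiv ℝ f) := (hf.fderiv_right h12).differentiable one_ne_zero
  have hh : ContDiff ℝ 2 (fun y ↦ f (x + ρ • y)) :=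
    hf.comp (contDiff_const.add (contDiff_const_smul ρ))
  have hDh : Differentiable ℝ (fderiv ℝ (fun y ↦ f (x + ρ • y))) :=
    (hh.fderiv_right h12).differentiable one_ne_zero
  rw [← fderiv_fderiv_apply_const (hDh w) u v]
  have hfun : (fun z ↦ fderiv ℝ (fun y ↦ f (x + ρ • y)) z v) =
      fun z ↦ ρ * (fun y ↦ fderiv ℝ f y v) (x + ρ • z) := by
    funext z
    exact fderiv_comp_dilation_apply hfd x ρ z v
  have hg : Differentiable ℝ (fun y ↦ fderiv ℝ f y v) := hDf.clm_apply (differentiable_const v)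
  have hgz : DifferentiableAt ℝ (fun z ↦ (fun y ↦ fderiv ℝ f y v) (x + ρ • z)) w :=
    (hg (x + ρ • w)).comp w ((differentiableAt_id.const_smul ρ).const_add x)
  rw [hfun, fderiv_const_mul hgz, FunLike.coe_smul, Pi.smul_apply, smul_eq_mul,
    fderiv_comp_dilation_apply hg x ρ w u, fderiv_fderiv_apply_const (hDf _) u v]
  ring

/-- **Second derivative of the spherical mean of a `C²` function**: `ρ ↦ ∫ Df(x + ρw)(w) dσ` has
derivative `∫ D²f(x + ρw)(w, w) dσ`. [folklore] -/
theorem hasDerivAt_sphereMean_fderiv_C2 {f : E3 → ℝ} (hf : ContDiff ℝ 2 f) (x : E3) (ρ : ℝ) :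
    HasDerivAt (fun ρ : ℝ ↦ ∫ w : Metric.sphere (0 : E3) 1, fderiv ℝ f (x + ρ • (w : E3)) (w : E3)
        ∂((volume : Measure E3).toSphere))
      (∫ w : Metric.sphere (0 : E3) 1, fderiv ℝ (fderiv ℝ f) (x + ρ • (w : E3)) (w : E3) (w : E3)
        ∂((volume : Measure E3).toSphere)) ρ := by
  -- adapted from …Theorems/StarvedNecksNecksCertifyStubSphereMeanDarboux.lean
  have hDf : ContDiff ℝ 1 (fderiv ℝ f) := hf.fderiv_right (by norm_num)
  have hG : ContDiff ℝ 1 (fun q : E3 × ℝ ↦ fderiv ℝ f (x + q.2 • q.1) q.1) :=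
    (hDf.comp (contDiff_const.add (contDiff_snd.smul contDiff_fst))).clm_apply contDiff_fst
  refine hasDerivAt_integral_toSphere_of_contDiff hG
    (G' := fun y ↦ fderiv ℝ (fderiv ℝ f) (x + ρ • y) y y) fun y ↦ ?_
  have haff : HasDerivAt (fun s : ℝ ↦ x + s • y) y ρ := by
    simpa using ((hasDerivAt_id ρ).smul_const y).const_add x
  have hc : HasDerivAt (fun s : ℝ ↦ fderiv ℝ f (x + s • y))
      (fderiv ℝ (fderiv ℝ f) (x + ρ • y) y) ρ :=
    ((hDf.differentiable one_ne_zero) (x + ρ • y)).hasFDerivAt.comp_hasDerivAt ρ haff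
  simpa using hc.clm_apply (hasDerivAt_const ρ y)

/-- **Darboux's identity, squared form, for `f ∈ C²`**: for all `x` and all real `ρ`,
`ρ² ∫ Δf(x + ρw) dσ = ρ² ∫ D²f(x + ρw)(w, w) dσ + 2ρ ∫ Df(x + ρw)(w) dσ`
(`integral_laplacian_toSphere` for `h = f(x + ρ ·)` and the chain rule). [folklore] -/
theorem sphereMean_darboux_sq_C2 {f : E3 → ℝ} (hf : ContDiff ℝ 2 f) (x : E3) (ρ : ℝ) :
    ρ ^ 2 * ∫ w : Metric.sphere (0 : E3) 1, (∑ i : Fin 3,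
        fderiv ℝ (fun z ↦ fderiv ℝ f z (EuclideanSpace.single i (1 : ℝ))) (x + ρ • (w : E3))
          (EuclideanSpace.single i (1 : ℝ))) ∂((volume : Measure E3).toSphere) =
      ρ ^ 2 * ∫ w : Metric.sphere (0 : E3) 1, fderiv ℝ (fderiv ℝ f) (x + ρ • (w : E3)) (w : E3)
        (w : E3) ∂((volume : Measure E3).toSphere) +
      2 * ρ * ∫ w : Metric.sphere (0 : E3) 1, fderiv ℝ f (x + ρ • (w : E3)) (w : E3)
        ∂((volume : Measure E3).toSphere) := by
  -- adapted from …Theorems/StarvedNecksNecksCertifyStubSphereMeanDarboux.lean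
  have h12 : (1 : WithTop ℕ∞) + 1 ≤ 2 := by norm_num
  have hfd : Differentiable ℝ f := hf.differentiable two_ne_zero
  have hDf : Differentiable ℝ (fderiv ℝ f) := (hf.fderiv_right h12).differentiable one_ne_zero
  have hc1 : Continuous (fderiv ℝ f) := hf.continuous_fderiv two_ne_zero
  have hc2 : Continuous (fderiv ℝ (fderiv ℝ f)) :=
    (hf.fderiv_right h12).continuous_fderiv one_ne_zero
  have hh2 : ContDiff ℝ 2 (fun y ↦ f (x + ρ • y)) :=
    hf.comp (contDiff_const.add (contDiff_const_smul ρ))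
  have hlap := integral_laplacian_toSphere hh2
  have hL : ∀ w : Metric.sphere (0 : E3) 1, (∑ i : Fin 3,
      fderiv ℝ (fderiv ℝ (fun y ↦ f (x + ρ • y))) w (EuclideanSpace.single i (1 : ℝ))
        (EuclideanSpace.single i (1 : ℝ))) =
      ρ ^ 2 * ∑ i : Fin 3, fderiv ℝ (fun z ↦ fderiv ℝ f z (EuclideanSpace.single i (1 : ℝ)))
        (x + ρ • (w : E3)) (EuclideanSpace.single i (1 : ℝ)) := by
    intro w
    rw [Finset.mul_sum]
    refine Finset.sum_congr rfl fun i _ ↦ ?_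
    rw [fderiv_fderiv_comp_dilation_apply_C2 hf, fderiv_fderiv_apply_const (hDf _)]
  have hR : ∀ w : Metric.sphere (0 : E3) 1,
      fderiv ℝ (fderiv ℝ (fun y ↦ f (x + ρ • y))) w w w + 2 * fderiv ℝ (fun y ↦ f (x + ρ • y)) w w
      = ρ ^ 2 * fderiv ℝ (fderiv ℝ f) (x + ρ • (w : E3)) w w +
        2 * ρ * fderiv ℝ f (x + ρ • (w : E3)) w := by
    intro w
    rw [fderiv_fderiv_comp_dilation_apply_C2 hf, fderiv_comp_dilation_apply hfd]
    ring
  have hint2 : Integrable (fun w : Metric.sphere (0 : E3) 1 ↦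
      ρ ^ 2 * fderiv ℝ (fderiv ℝ f) (x + ρ • (w : E3)) w w) ((volume : Measure E3).toSphere) :=
    integrable_toSphere_of_continuous (by fun_prop)
  have hint1 : Integrable (fun w : Metric.sphere (0 : E3) 1 ↦
      2 * ρ * fderiv ℝ f (x + ρ • (w : E3)) w) ((volume : Measure E3).toSphere) :=
    integrable_toSphere_of_continuous (by fun_prop)
  rw [integral_congr_ae (ae_of_all _ hL), integral_congr_ae (ae_of_all _ hR), integral_const_mul,
    integral_add hint2 hint1, integral_const_mul, integral_const_mul] at hlap
  exact hlap

/-- **Darboux's equation for the spherical means of a `C²` function** (Evans, *PDE*, §2.4.1,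
Lemma 1): `(ρ M)''(r) = r ∫ Δf(x + rw) dσ` for `M(ρ) = ∫_{S²} f(x + ρw) dσ(w)` — from
`(ρM)'' = 2M' + ρM''`, the squared identity `sphereMean_darboux_sq_C2` for `r ≠ 0`, and
`M'(0) = ∫ Df(x)(w) dσ = 0` (antipodal symmetry) at `r = 0`. [folklore] -/
theorem sphereMean_darboux_C2 {f : E3 → ℝ} (hf : ContDiff ℝ 2 f) (x : E3) (r : ℝ) :
    iteratedDeriv 2 (fun ρ : ℝ ↦ ρ * ∫ (w : Metric.sphere (0 : E3) 1), f (x + ρ • (w : E3))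
        ∂((volume : Measure E3).toSphere)) r =
      r * ∫ (w : Metric.sphere (0 : E3) 1), (∑ i : Fin 3,
        fderiv ℝ (fun z ↦ fderiv ℝ f z (EuclideanSpace.single i (1 : ℝ))) (x + r • (w : E3))
          (EuclideanSpace.single i (1 : ℝ))) ∂((volume : Measure E3).toSphere) := by
  -- adapted from …Theorems/StarvedNecksNecksCertifyStubSphereMeanDarboux.lean
  rw [iteratedDeriv_two_id_mul (hasDerivAt_sphereMean_C1 (hf.of_le (by norm_num)) x)
    (hasDerivAt_sphereMean_fderiv_C2 hf x) r]
  have hD := sphereMean_darboux_sq_C2 hf x r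
  rcases eq_or_ne r 0 with hr | hr
  · subst hr
    have h0 : ∫ w : Metric.sphere (0 : E3) 1, fderiv ℝ f (x + (0 : ℝ) • (w : E3)) (w : E3)
        ∂((volume : Measure E3).toSphere) = 0 := by
      simp only [zero_smul, add_zero]
      exact integral_fderiv_centre_eq_zero f x
    rw [h0]
    ring
  · apply mul_left_cancel₀ hr
    linear_combination (-1 : ℝ) * hD

/-! ### Time-dependent spherical means of a `C²` function on `E4` -/

/-- **Joint `C²` regularity** of `(s, r) ↦ ∫_{S²} ψ(s, x + r w) dσ(w)` for `ψ ∈ C²` (the integrand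
`(w, (s, r)) ↦ ψ(s, x + r w)` is jointly `C²`, the sphere is compact). [folklore] -/
theorem contDiff_sphericalMean_C2 {ψ : E4 → ℝ} (hψ : ContDiff ℝ 2 ψ) (x : E3) :
    ContDiff ℝ 2 fun p : ℝ × ℝ ↦ ∫ (w : Metric.sphere (0 : E3) 1),
      ψ (E4.ofTimeSpace p.1 (x + p.2 • (w : E3))) ∂((volume : Measure E3).toSphere) :=
  -- adapted from …Theorems/StarvedNecksNecksCertifyStubSphericalMeansCalculus.lean
  contDiff_nat_parametric_integral_of_contDiff (μ := (volume : Measure E3).toSphere)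
    (ι := (Subtype.val : Metric.sphere (0 : E3) 1 → E3)) measurable_subtype_coe
    (isCompact_sphere (0 : E3) 1) (Eventually.of_forall fun w ↦ w.2) 2
    (G := fun q : E3 × (ℝ × ℝ) ↦ ψ (E4.ofTimeSpace q.2.1 (x + q.2.2 • q.1)))
    (hψ.comp ((contDiff_sliceMap x).of_le (WithTop.coe_le_coe.2 le_top)))

/-- **Time derivative under the integral sign** for `ψ ∈ C¹`:
`∂ₛ ∫ ψ(s, x + rw) dσ = ∫ ∂₀ψ(s, x + rw) dσ`. [folklore] -/
theorem hasDerivAt_sphericalMean_time_C1 {ψ : E4 → ℝ} (hψ : ContDiff ℝ 1 ψ) (x : E3) (r s : ℝ) :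
    HasDerivAt (fun s' : ℝ ↦ ∫ (w : Metric.sphere (0 : E3) 1),
        ψ (E4.ofTimeSpace s' (x + r • (w : E3))) ∂((volume : Measure E3).toSphere))
      (∫ (w : Metric.sphere (0 : E3) 1), fderiv ℝ ψ (E4.ofTimeSpace s (x + r • (w : E3)))
        (E4.basisVector 0) ∂((volume : Measure E3).toSphere)) s := by
  -- adapted from …Theorems/StarvedNecksNecksCertifyStubSphericalMeansCalculus.lean
  have hG : ContDiff ℝ 1 fun q : E3 × ℝ ↦ ψ (E4.ofTimeSpace q.2 (x + r • q.1)) :=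
    hψ.comp (((contDiff_sliceMap x).of_le (WithTop.coe_le_coe.2 le_top)).comp
      (contDiff_fst.prodMk (contDiff_snd.prodMk contDiff_const) :
        ContDiff ℝ 1 fun q : E3 × ℝ ↦ ((q.1, (q.2, r)) : E3 × (ℝ × ℝ))))
  refine hasDerivAt_integral_toSphere_of_contDiff hG
    (G' := fun y ↦ fderiv ℝ ψ (E4.ofTimeSpace s (x + r • y)) (E4.basisVector 0)) fun y ↦ ?_
  exact ((hψ.differentiable one_ne_zero) _).hasFDerivAt.comp_hasDerivAt s
    (hasDerivAt_ofTimeSpace_time (x + r • y) s)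

/-- **Radial derivative under the integral sign** for `ψ ∈ C¹`:
`∂ᵣ ∫ ψ(s, x + rw) dσ = ∫ Dψ(s, x + rw)·(0, w) dσ`. [folklore] -/
theorem hasDerivAt_sphericalMean_radius_C1 {ψ : E4 → ℝ} (hψ : ContDiff ℝ 1 ψ) (x : E3)
    (s r : ℝ) :
    HasDerivAt (fun ρ : ℝ ↦ ∫ (w : Metric.sphere (0 : E3) 1),
        ψ (E4.ofTimeSpace s (x + ρ • (w : E3))) ∂((volume : Measure E3).toSphere))
      (∫ (w : Metric.sphere (0 : E3) 1), fderiv ℝ ψ (E4.ofTimeSpace s (x + r • (w : E3)))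
        (E4.ofTimeSpace 0 (w : E3)) ∂((volume : Measure E3).toSphere)) r := by
  -- adapted from …Theorems/StarvedNecksNecksCertifyStubSphericalMeansCalculus.lean
  have hG : ContDiff ℝ 1 fun q : E3 × ℝ ↦ ψ (E4.ofTimeSpace s (x + q.2 • q.1)) :=
    hψ.comp (((contDiff_sliceMap x).of_le (WithTop.coe_le_coe.2 le_top)).comp
      (contDiff_fst.prodMk (contDiff_const.prodMk contDiff_snd) :
        ContDiff ℝ 1 fun q : E3 × ℝ ↦ ((q.1, (s, q.2)) : E3 × (ℝ × ℝ))))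
  refine hasDerivAt_integral_toSphere_of_contDiff hG
    (G' := fun y ↦ fderiv ℝ ψ (E4.ofTimeSpace s (x + r • y)) (E4.ofTimeSpace 0 y)) fun y ↦ ?_
  exact ((hψ.differentiable one_ne_zero) _).hasFDerivAt.comp_hasDerivAt r
    (hasDerivAt_ofTimeSpace_radius s x y r)

/-! ### The registered stub -/

/-- **Stub S2a `stub_sphericalMeansCalculusC2`** (registered on stmt-FinalStateConjecture-17402,
line `cone-rates-are-iled`): calculus of time-dependent spherical means for `C²` data (Evans,
*PDE*, §2.4.1).  For `ψ ∈ C²(E4)`, a spatial centre `x : E3` and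
`A(s, r) := ∫_{S²} ψ(s, x + r w) dσ(w)` (pinned by its defining equation): `A` is jointly `C²` on
`ℝ²` (`contDiff_sphericalMean_C2`); `∂ᵣA = ∫ Dψ·(0, w)` (`hasDerivAt_sphericalMean_radius_C1`),
`∂ₛA = ∫ ∂₀ψ` and `∂ₛ²A = ∫ ∂₀∂₀ψ` (`hasDerivAt_sphericalMean_time_C1`, applied to `ψ ∈ C¹` and
to `∂₀ψ ∈ C¹`); and Darboux in the radius, `∂ᵣ²(r A(s, r)) = r ∫ (Δₓψ)(s, x + rw) dσ`
(`sphereMean_darboux_C2` for the `C²` slice `f = ψ ∘ E4.ofTimeSpace s`, plus the chain rule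
`fderiv_comp_ofTimeSpace_single`, twice). [folklore] -/
theorem stub_sphericalMeansCalculusC2 :
    ∀ (ψ : E4 → ℝ), ContDiff ℝ 2 ψ → ∀ (x : E3) (A : ℝ → ℝ → ℝ), (∀ s r, A s r = ∫ (w : Metric.sphere (0 : E3) 1), ψ (E4.ofTimeSpace s (x + r • (w : E3))) ∂((volume : Measure E3).toSphere)) → ContDiff ℝ 2 (Function.uncurry A) ∧ (∀ s r, deriv (A s) r = ∫ (w : Metric.sphere (0 : E3) 1), fderiv ℝ ψ (E4.ofTimeSpace s (x + r • (w : E3))) (E4.ofTimeSpace 0 (w : E3)) ∂((volume : Measure E3).toSphere)) ∧ (∀ s r, deriv (fun s' ↦ A s' r) s = ∫ (w : Metric.sphere (0 : E3) 1), fderiv ℝ ψ (E4.ofTimeSpace s (x + r • (w : E3))) (E4.basisVector 0) ∂((volume : Measure E3).toSphere)) ∧ (∀ s r, iteratedDeriv 2 (fun s' ↦ A s' r) s = ∫ (w : Metric.sphere (0 : E3) 1), fderiv ℝ (fun z ↦ fderiv ℝ ψ z (E4.basisVector 0)) (E4.ofTimeSpace s (x + r • (w : E3))) (E4.basisVector 0)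 ∂((volume : Measure E3).toSphere)) ∧ (∀ s r, iteratedDeriv 2 (fun ρ ↦ ρ * A s ρ) r = r * ∫ (w : Metric.sphere (0 : E3) 1), (∑ i : Fin 3, fderiv ℝ (fun z ↦ fderiv ℝ ψ z (E4.basisVector i.succ)) (E4.ofTimeSpace s (x + r • (w : E3))) (E4.basisVector i.succ)) ∂((volume : Measure E3).toSphere)) := by
  -- adapted from …Theorems/StarvedNecksNecksCertifyStubSphericalMeansCalculus.lean
  intro ψ hψ x A hA
  have hψ1 : ContDiff ℝ 1 ψ := hψ.of_le (by norm_num)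
  -- the pinned `A` as explicit parametric integrals
  have hAu : Function.uncurry A = fun p : ℝ × ℝ ↦ ∫ (w : Metric.sphere (0 : E3) 1),
      ψ (E4.ofTimeSpace p.1 (x + p.2 • (w : E3))) ∂((volume : Measure E3).toSphere) :=
    funext fun p ↦ hA p.1 p.2
  have hAr : ∀ s, A s = fun ρ : ℝ ↦ ∫ (w : Metric.sphere (0 : E3) 1),
      ψ (E4.ofTimeSpace s (x + ρ • (w : E3))) ∂((volume : Measure E3).toSphere) :=
    fun s ↦ funext (hA s)
  have hAs : ∀ r, (fun s' ↦ A s' r) = fun s' : ℝ ↦ ∫ (w : Metric.sphere (0 : E3) 1),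
      ψ (E4.ofTimeSpace s' (x + r • (w : E3))) ∂((volume : Measure E3).toSphere) :=
    fun r ↦ funext fun s' ↦ hA s' r
  refine ⟨?_, fun s r ↦ ?_, fun s r ↦ ?_, fun s r ↦ ?_, fun s r ↦ ?_⟩
  · -- (1) joint `C²` regularity
    rw [hAu]
    exact contDiff_sphericalMean_C2 hψ x
  · -- (2) radial derivative
    rw [hAr s]
    exact (hasDerivAt_sphericalMean_radius_C1 hψ1 x s r).deriv
  · -- (3) time derivative
    rw [hAs r]
    exact (hasDerivAt_sphericalMean_time_C1 hψ1 x r s).deriv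
  · -- (4) second time derivative: (3) for `ψ ∈ C¹`, then (3) for `∂₀ψ ∈ C¹`
    have hψ₀ : ContDiff ℝ 1 fun z ↦ fderiv ℝ ψ z (E4.basisVector 0) :=
      (hψ.fderiv_right (m := 1) (by norm_num)).clm_apply contDiff_const
    have h1 : deriv (fun s' ↦ A s' r) = fun s' : ℝ ↦ ∫ (w : Metric.sphere (0 : E3) 1),
        fderiv ℝ ψ (E4.ofTimeSpace s' (x + r • (w : E3))) (E4.basisVector 0)
          ∂((volume : Measure E3).toSphere) := by
      rw [hAs r]
      exact funext fun s' ↦ (hasDerivAt_sphericalMean_time_C1 hψ1 x r s').deriv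
    rw [iteratedDeriv_succ, iteratedDeriv_one, h1]
    exact (hasDerivAt_sphericalMean_time_C1 hψ₀ x r s).deriv
  · -- (5) Darboux in the radius: `sphereMean_darboux_C2` on the slice `f = ψ(s, ·)`
    have hf : ContDiff ℝ 2 fun y : E3 ↦ ψ (E4.ofTimeSpace s y) :=
      hψ.comp ((contDiff_ofTimeSpace_space s).of_le (WithTop.coe_le_coe.2 le_top))
    have hρ : (fun ρ : ℝ ↦ ρ * A s ρ) = fun ρ : ℝ ↦
        ρ * ∫ (w : Metric.sphere (0 : E3) 1),
          ψ (E4.ofTimeSpace s (x + ρ • (w : E3))) ∂((volume : Measure E3).toSphere) :=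
      funext fun ρ ↦ by rw [hA]
    rw [hρ]
    refine (sphereMean_darboux_C2 hf x r).trans ?_
    congr 1
    refine integral_congr_ae (Eventually.of_forall fun w ↦ ?_)
    refine Finset.sum_congr rfl fun i _ ↦ ?_
    have hψi : Differentiable ℝ fun z ↦ fderiv ℝ ψ z (E4.basisVector i.succ) :=
      ((hψ.fderiv_right (m := 1) (by norm_num)).clm_apply contDiff_const).differentiable
        one_ne_zero
    have heq : (fun z : E3 ↦ fderiv ℝ (fun y : E3 ↦ ψ (E4.ofTimeSpace s y)) z
        (EuclideanSpace.single i (1 : ℝ))) =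
        fun z : E3 ↦
          (fun z' : E4 ↦ fderiv ℝ ψ z' (E4.basisVector i.succ)) (E4.ofTimeSpace s z) :=
      funext fun z ↦ fderiv_comp_ofTimeSpace_single (hψ.differentiable two_ne_zero) s z i
    rw [heq, fderiv_comp_ofTimeSpace_single hψi s (x + r • (w : E3)) i]

end Summit.FinalStateConjecture.FinalStateConjecture.Theorems.EIHFluxBalance.ConeRatesAreILED

end
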